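import Literature.IUT.HodgeTheaters.Cor53iFcircNotLiftsAllAtFstCarrier
import Literature.IUT.HodgeTheaters.GlobalFrobenioidsArithmeticClosers
import Literature.AnabelianGeometry.AbsoluteAnabelian.AbsTopIII.BiAnabelianModelLiftVacuity
import HarnessLib

/-!
# [IUTchI] Cor 5.3 (i) «resp. ⊚» at the `pr₁` push carrier: the exact verdict — INJECTIVE, NOT surjective, record type INHABITED

S. Mochizuki, *Inter-universal Teichmüller theory I*, kurims manuscript (May 2020), §5 Cor 5.3 (i) p. 144 l. 2–11; Example 5.1 (i) p. 123,
(iii) pp. 125–126 ([IUTchI] Cor 5.3 (i) p.144) [claim: Mochizuki2012, status: disputed] (D-0012 claim key; nothing of the series is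
asserted; no side taken on [IUTchIII] Cor. 3.12).  [FrdI] Prop 1.6 p. 27, Ex 6.3 p. 113 [cite: MochizukiFrdI2008, Ex. 6.3 p.113].

PROOF-ONLY rider (cell abc-iut, seat abc-iut-L5-t4 gen 12, «PR1-VERDICT-EXACT» after row «HLIFT⊚-FALSE@PR1»; 0 def · 0 instance · no Prop
fact): three one-call compositions BY NAME, so that the census sentence «at `pr₁` the natural map `Aut(†ℱ^⊚) → Aut(†𝒟^⊚)` is injective and
not surjective, and the record type is inhabited» is ONE kernel statement each — ★ `nonempty_globalFrobenioid` (abc-iut-w4-d050), ★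
`Cor53.fcirc_descend_injective_of_pushCarrier` (abc-iut-L5-t4 g9 / t11, `hZ` := ★ `AbsTopIII.isSlimGroup_prod` of ★ `isSlimGroup_absGalGrp`),
★ `Cor53.not_liftsAll_fcircBase_fstPushCarrier` / ★ `Cor53.not_fcirc_descendBijective_fstPushCarrier` (gen 12).  OUR stand-in carrier
(print's class is open INJECTIONS, [IUTchI] Ex 5.1 (i) p.123); typed ≠ inhabited ≠ proved; not an abc claim. -/

noncomputable section

namespace Literature.IUT.HodgeTheaters

open CategoryTheory Literature.AlgebraicGeometry.Frobenioids Literature.AnabelianGeometry.SemiGraphs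
open Literature.AnabelianGeometry.AbsoluteAnabelian

variable (F : Type) [Field F] [NumberField F]

/-- `G_F × G_F` is slim (products of slim groups, ★ `AbsTopIII.isSlimGroup_prod`; `G_F` slim, ★ `isSlimGroup_absGalGrp`).
([IUTchI] Ex 5.1 (i) p.123) [cite: MochizukiFrdI2008, Prop. 1.6 p.27] [claim: Mochizuki2012, status: disputed] -/
theorem isSlimGroup_absGalGrp_prod : IsSlimGroup (ProfiniteGrp.of (absGalGrp F × absGalGrp F)) :=
  AbsTopIII.isSlimGroup_prod (isSlimGroup_absGalGrp F) (isSlimGroup_absGalGrp F)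

/-- **Typed ≠ inhabited guard at `pr₁`**: the [IUTchI] Ex 5.1 (iii) record type over the `pr₁` push carrier is INHABITED, and for EVERY
inhabitant the lifting binder `hlift⊚` FAILS. ([IUTchI] Cor 5.3 (i) p.144) [cite: MochizukiFrdI2008, Ex. 6.3 p.113] [claim: Mochizuki2012, status: disputed] -/
theorem Cor53.nonempty_and_not_liftsAll_fstPushCarrier :
    Nonempty (GlobalFrobenioid (GlobalDivisorData.arith F) (BaseCat (ProfiniteGrp.of (absGalGrp F × absGalGrp F)))
        (baseToCoset (ProfiniteGrp.of (absGalGrp F × absGalGrp F)) ⋙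
          CosetCat.push (MonoidHom.fst (absGalGrp F) (absGalGrp F)) isOpenMap_fst ⋙ cosetToBase (absGalGrp F))) ∧
      ∀ 𝓕 : GlobalFrobenioid (GlobalDivisorData.arith F) (BaseCat (ProfiniteGrp.of (absGalGrp F × absGalGrp F)))
          (baseToCoset (ProfiniteGrp.of (absGalGrp F × absGalGrp F)) ⋙
            CosetCat.push (MonoidHom.fst (absGalGrp F) (absGalGrp F)) isOpenMap_fst ⋙ cosetToBase (absGalGrp F)),
        ¬ ∀ Θ : BaseCat (ProfiniteGrp.of (absGalGrp F × absGalGrp F)) ≌ BaseCat (ProfiniteGrp.of (absGalGrp F × absGalGrp F)),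
            ∃ Ψ : 𝓕.Fcirc ≌ 𝓕.Fcirc, Nonempty (CatIsomorphism.LiesUnder 𝓕.fcircBase 𝓕.fcircBase Ψ Θ) :=
  ⟨nonempty_globalFrobenioid _ _ _, fun 𝓕 => Cor53.not_liftsAll_fcircBase_fstPushCarrier F 𝓕⟩

variable (𝓕 : GlobalFrobenioid (GlobalDivisorData.arith F) (BaseCat (ProfiniteGrp.of (absGalGrp F × absGalGrp F)))
  (baseToCoset (ProfiniteGrp.of (absGalGrp F × absGalGrp F)) ⋙
    CosetCat.push (MonoidHom.fst (absGalGrp F) (absGalGrp F)) isOpenMap_fst ⋙ cosetToBase (absGalGrp F)))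

/-- **INJECTIVE at `pr₁`**: the natural map `Aut(†ℱ^⊚) → Aut(†𝒟^⊚)` (canonical binders of abc-iut-w4-d109's ★
`hasUnder_and_underUnique_fcircBase_arith_baseCat`, `hZ` discharged by `isSlimGroup_absGalGrp_prod`) is injective for every record —
★ `Cor53.fcirc_descend_injective_of_pushCarrier` at `ι := pr₁`. ([IUTchI] Cor 5.3 (i) p.144) [cite: MochizukiFrdI2008, Prop. 1.6 p.27]
[claim: Mochizuki2012, status: disputed] -/
theorem Cor53.fcirc_descend_injective_fstPushCarrier :
    Function.Injective (CatIsomorphism.descend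
      (GlobalFrobenioid.hasUnder_and_underUnique_fcircBase_arith_baseCat 𝓕 𝓕
        (isSlimGroup_absGalGrp_prod F) (isSlimGroup_absGalGrp_prod F)).1
      (GlobalFrobenioid.hasUnder_and_underUnique_fcircBase_arith_baseCat 𝓕 𝓕
        (isSlimGroup_absGalGrp_prod F) (isSlimGroup_absGalGrp_prod F)).2) :=
  Cor53.fcirc_descend_injective_of_pushCarrier F (ProfiniteGrp.of (absGalGrp F × absGalGrp F))
    (MonoidHom.fst (absGalGrp F) (absGalGrp F)) continuous_fst isOpenMap_fst (isSlimGroup_absGalGrp_prod F) 𝓕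

/-- **THE VERDICT AT `pr₁`: injective and NOT surjective** — [IUTchI] Cor 5.3 (i) «resp. ⊚» («bijective») fails there EXACTLY at
surjectivity (lifting), for every record over the arithmetic divisor data.  OUR stand-in carrier; print's carrier class is open
INJECTIONS, where the map is bijective unconditionally (★ `Cor53.fcirc_descendBijective_of_openEmbedding`).  No side on [IUTchIII]
Cor 3.12; not an abc claim. ([IUTchI] Cor 5.3 (i) p.144) [cite: MochizukiFrdI2008, Ex. 6.3 p.113] [claim: Mochizuki2012, status: disputed] -/
theorem Cor53.fcirc_descend_injective_and_not_surjective_fstPushCarrier :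
    Function.Injective (CatIsomorphism.descend
        (GlobalFrobenioid.hasUnder_and_underUnique_fcircBase_arith_baseCat 𝓕 𝓕
          (isSlimGroup_absGalGrp_prod F) (isSlimGroup_absGalGrp_prod F)).1
        (GlobalFrobenioid.hasUnder_and_underUnique_fcircBase_arith_baseCat 𝓕 𝓕
          (isSlimGroup_absGalGrp_prod F) (isSlimGroup_absGalGrp_prod F)).2) ∧
      ¬ Function.Surjective (CatIsomorphism.descend
        (GlobalFrobenioid.hasUnder_and_underUnique_fcircBase_arith_baseCat 𝓕 𝓕
          (isSlimGroup_absGalGrp_prod F) (isSlimGroup_absGalGrp_prod F)).1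
        (GlobalFrobenioid.hasUnder_and_underUnique_fcircBase_arith_baseCat 𝓕 𝓕
          (isSlimGroup_absGalGrp_prod F) (isSlimGroup_absGalGrp_prod F)).2) :=
  ⟨Cor53.fcirc_descend_injective_fstPushCarrier F 𝓕, fun hs =>
    Cor53.not_fcirc_descendBijective_fstPushCarrier F 𝓕 _ _ ⟨Cor53.fcirc_descend_injective_fstPushCarrier F 𝓕, hs⟩⟩

end Literature.IUT.HodgeTheaters

end
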